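import Literature.MathematicalPhysics.StatisticalMechanics.CubicLatticeFluctuations
import HarnessLib

/-!
# The side face of the quasicube arithmetic ([MPSS19] §3) and the `N^{3/4}` law discharged

[topic MathematicalPhysics/StatisticalMechanics]

`CubicLatticeFluctuations.lean` (≈ 200 KB, at the gate's file-size cap) reduces the vendored fact
`MaininiPiovanoSchmidtStefanelli2019_thm11` ([MPSS19, Theorem 1.1], the `N^{3/4}` law for the edge
isoperimetric problem on `ℤ³`) to ONE arithmetic statement, the hypothesis of
`MaininiPiovanoSchmidtStefanelli2019_thm11_of_sideFace_bound` (the "side-face case": projection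
`q(σ) < M < q(σ+1)`), and proves Step 3 of [MPSS19] §3 in all the forms needed (pure boxes, spare
levels, hosted side rows).  This file continues from there and completes the proof: it proves the
side-face arithmetic (`sideFace_height_pow_four_le`) and hence DISCHARGES the fact,
`MaininiPiovanoSchmidtStefanelli2019_thm11_holds` (placed here because the fact's own file
`EdgeIsoperimetricFluctuations.lean` is upstream of this development and cannot import it).

## Main statements (all proved, no named facts)

* `exists_rows` (private): a surplus `S ≤ uθ`, `S ≤ (a + b)θ` splits into at most `u` rows of length `≤ θ`, at
  most `a ≥ 1` of them in a first group and at most `b` in a second [folklore].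
* `tall_quasicube_sideRows`, `tall_quasicube_odd_sideRows`: **CASE I of the side-face case in
  numeric form** — a tall quasicube profile (`p + 3k + e` levels of the quasi-square `p²` resp.
  `p(p+1)`, top level `d`) carrying a projection `M = Q + θ` (`1 ≤ θ ≤ p`), `u` top-class levels and
  a surplus `S ≤ uθ` that fits on the competitor's host levels, `S ≤ (p + k − 1 + e)θ`, obeys the
  Step-3 inequality `9k⁴ + 6k² < 4p + 8k³ + 4k` resp. `9k⁴ + 9k² ≤ 4p + 14k³ + 4k`
  (via `tall_quasicube_hosted` / `tall_quasicube_odd_hosted`).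
  [cite: MaininiPiovanoSchmidtStefanelli2019, §3 Steps 2–3]
* `stepThree_tail_slack`, `stepThree_tail_odd_slack`: the Step-3 tails with an overflow cost `E`
  (`2(p+k) ≤ 3k² + E + ⌈2√ρ₀⌉` resp. `2p + 3k + 1 ≤ 3k² + E + ⌈2√ρ₀⌉` still give `9k⁴ = O_E(p)`),
  for the tiny-`θ` sub-case of the side face. [cite: MaininiPiovanoSchmidtStefanelli2019, §3 Step 3]

* `cubicEIP_le_of_le_multisetSum`, `cubicEIP_mono`: the competitor bound against a multiset of
  volume `≥ n` (shrink levels; `⌈2√·⌉` is monotone), and the monotonicity of `G₃ = EIP³/2`.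
  [cite: MaininiPiovanoSchmidtStefanelli2019, §2.2]
* `tall_quasicube_shrunk`, `tall_quasicube_odd_shrunk`: **CASE II of the side face** — when all
  but `≤ 2k` of the `c − 1` levels are top-class, read the profile as the `q(σ+1)`-box with
  missing points: the Step-3 competitor of THAT box (other parity) with `⌊(σ+1)/2⌋ − θ` points
  removed from every big level (lowering the maximum) and the `w = c − 1 − u` plain levels shrunk
  back to `q(σ)` has volume `≥ n` and cost `= [Step-3 cost] − (⌊(σ+1)/2⌋ − θ) − w`, so the Step-3
  inequality of the other parity survives verbatim. [cite: MaininiPiovanoSchmidtStefanelli2019, §3 Steps 2–3]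
* `sideFace_height_pow_four_le`: **the side-face arithmetic** — the hypothesis of
  `MaininiPiovanoSchmidtStefanelli2019_thm11_of_sideFace_bound` with `K = 3297024⁴`: for every
  admissible `k` (`6k ≤` height excess, `k² ≤ p/3`) CASE I or CASE II applies and gives
  `9k⁴ ≤ 4p + 14k³ + 4k + 3`; with `k = min(⌊h/6⌋, ⌊√(p/3)⌋)` this is `h⁴ ≤ 58564·p` for
  `p = ⌊σ/2⌋ ≥ 27` (`height_pow_four_le`), and `σ ≤ 53` is covered by the a-priori bound
  `c − 1 ≤ 62208σ` (`quasicube_levels_le`); a top level beyond `q(σ)` is re-indexed as a further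
  top-class level. [cite: MaininiPiovanoSchmidtStefanelli2019, §3 Steps 2–4]
* `MaininiPiovanoSchmidtStefanelli2019_thm11_holds`: **[MPSS19] Theorem 1.1, the `N^{3/4}` law in
  `ℤ³`, is a theorem of the tree** (`…_of_sideFace_bound sideFace_height_pow_four_le`).
  [cite: MaininiPiovanoSchmidtStefanelli2019, Theorem 1.1]
* `quasicube_height_pow_four_le`, `IsEIPMinimizer.box_sides_sharp`: the quasicube arithmetic in
  full (pure box + side face: the hypothesis of `…_thm11_of_quasicube_bound` as a theorem) and
  **[MPSS19] eq. (3.2)** in integer form — every non-empty `EIP³` minimizer has all three sides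
  within `2D + 4` of `⌊∛n⌋ + 1` for a `D` with `D⁴ ≤ K(3⌊∛n⌋ + 5)`, i.e. its bounding box is a cube
  up to `O(n^{1/12})`. [cite: MaininiPiovanoSchmidtStefanelli2019, §3 eq. (3.2)]
* `MaininiSchmidt2020_thm11_upper_three`: the `d = 3` instance of the vendored `∀ d` fact
  `MaininiSchmidt2020_thm11_upper` ([MS20] Theorem 1.1 (i): `#((C − a) △ {1,…,⌊∛n⌋}³) ≤ K n^{3/4}`,
  no remainder term), from the previous item (the two Wulff cubes differ by `≤ 7⌊∛n⌋²` points; the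
  `o(n^{3/4})` is absorbed into `K`); with `MaininiSchmidt2020_thm11_lower_three`
  (`CubicLatticeEdgeIsoperimetry`) both halves of [MS20] Theorem 1.1 hold at `d = 3`, as at `d = 2`
  (`SquareLatticeEdgeIsoperimetry`). [cite: MaininiSchmidt2020, Theorem 1.1 (i)]

## The architecture of the whole proof (files `CubicLatticeEdgeIsoperimetry`,
## `CubicLatticeFluctuations`, this file), against [MPSS19] §3

* EIP³ solved exactly (`two_mul_cubicEIP_le_card_boundaryPairs`, `G₃ = cubicEIP`) replaces the
  paper's use of [MPS14]/Alonso–Cerf for the value of `EIP_n` and of the 2D daisies.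
* §3 eq. (3.1) (no gaps) and the box `T₀ × T₁ × T₂` with `T_j + T_k = ⌈2√M_i⌉`, `Σ M_i = G₃(n)`:
  `CubicLatticeFluctuations` §§NoGap–Box; the theorem follows from the box estimate (3.2) alone:
  `MaininiPiovanoSchmidtStefanelli2019_thm11_of_box_bound` (Step 5 and the `o(n^{3/4})` bookkeeping).
* Steps 1–2 (cuboidification): at the level of the multiset of slice sizes along an axis —
  `IsOptimalLevels`, the exchange `{x, y} ↦ {q(σ), x + y − q(σ)}`, canonical form and the
  quasicube accounting `G₃(n) = M + (c−1)σ + u + ⌈2√d⌉` (`…exists_quasicube_accounting`), whence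
  `…_thm11_of_quasicube_bound` (per-axis fourth-root deviation ⇒ (3.2)).
* Step 3 (the rearrangement `M̃_n` and the fourth-order cancellation `4αℓ = 9k⁴ + …`): as
  competitor multisets — `tall_quasicube(_odd)` (pure boxes, spare levels, free top level: the
  residues `r ∈ {0,1,2}` of the paper disappear), `pureBox_*` (all `p`), `…_of_sideFace_bound`;
  the side face `F²`: CASE I `tall_quasicube(_odd)_hosted/_sideRows` (surplus hosted on the
  competitor), CASE II `tall_quasicube(_odd)_shrunk` (the `q(σ+1)`-view), glued here.
* Step 4 (`ℓ₃ − ℓ = O(ℓ^{1/4})` ⇒ all sides within `O(n^{1/12})`): `height_pow_four_le` +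
  `IsEIPMinimizer.exists_box_dev_of_quasicube`.
Constants are explicit but not optimized (`K = 3297024⁴` in the side-face bound; the printed
`K₁` is not claimed).

## References

* [MS20] E. Mainini, B. Schmidt, *Maximal fluctuations around the Wulff shape for edge-isoperimetric
  sets in ℤ^d: a sharp scaling law*, Comm. Math. Phys. 380 (2020) 947–971, arXiv:2003.01679 —
  Theorem 1.1 (i), §1 (W_n).
* [MPSS19] E. Mainini, P. Piovano, B. Schmidt, U. Stefanelli, *N^{3/4} law in the cubic lattice*,
  J. Stat. Phys. 176 (2019) 1480–1499, arXiv:1807.00811 — §2.2, §3 (Steps 1–5, eqs. (3.1)–(3.13)),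
  Theorem 1.1.
-/

namespace Literature.MathematicalPhysics.StatisticalMechanics

open Finset

section SideFaceRows

/-- Splitting a surplus `S ≤ uθ`, `S ≤ (a + b)θ` into at most `u` rows of length `≤ θ`, at most `a ≥ 1`
of them in the first group and at most `b` in the second. [folklore] -/
private theorem exists_rows {S θ u a b : ℕ} (hθ : 1 ≤ θ) (ha : 1 ≤ a) (hSu : S ≤ u * θ)
    (hSH : S ≤ (a + b) * θ) :
    ∃ s₁ s₂ : Multiset ℕ, (∀ t ∈ s₁, 1 ≤ t ∧ t ≤ θ) ∧ (∀ t ∈ s₂, 1 ≤ t ∧ t ≤ θ) ∧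
      Multiset.card s₁ ≤ a ∧ Multiset.card s₂ ≤ b ∧
      Multiset.card s₁ + Multiset.card s₂ ≤ u ∧ s₁.sum + s₂.sum = S := by
  classical
  set r := S / θ with hr
  set s0 := S % θ with hs0
  have hS : S = r * θ + s0 := by rw [hr, hs0, mul_comm, Nat.div_add_mod S θ]
  have hs0θ : s0 < θ := Nat.mod_lt _ (by omega)
  by_cases h0 : s0 = 0
  · -- only full rows
    have hru : r ≤ u := by
      by_contra h; push Not at h
      have : u * θ + θ ≤ r * θ := by nlinarith
      omega
    have hrH : r ≤ a + b := by
      by_contra h; push Not at h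
      have : (a + b) * θ + θ ≤ r * θ := by nlinarith
      omega
    refine ⟨Multiset.replicate (min r a) θ, Multiset.replicate (r - min r a) θ, ?_, ?_, ?_, ?_, ?_, ?_⟩
    · intro t ht; rw [Multiset.mem_replicate] at ht; omega
    · intro t ht; rw [Multiset.mem_replicate] at ht; omega
    · rw [Multiset.card_replicate]; exact min_le_right _ _
    · rw [Multiset.card_replicate]; omega
    · rw [Multiset.card_replicate, Multiset.card_replicate]; omega
    · rw [Multiset.sum_replicate, Multiset.sum_replicate, smul_eq_mul, smul_eq_mul, hS, h0]
      have : min r a + (r - min r a) = r := by omega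
      rw [add_zero, ← Nat.add_mul, this]
  · -- `r` full rows and one partial row `s0`, hosted in the first group
    have hru : r + 1 ≤ u := by
      by_contra h; push Not at h
      have : u * θ ≤ r * θ := Nat.mul_le_mul_right θ (by omega)
      omega
    have hrH : r + 1 ≤ a + b := by
      by_contra h; push Not at h
      have : (a + b) * θ ≤ r * θ := Nat.mul_le_mul_right θ (by omega)
      omega
    refine ⟨s0 ::ₘ Multiset.replicate (min r (a - 1)) θ, Multiset.replicate (r - min r (a - 1)) θ,
      ?_, ?_, ?_, ?_, ?_, ?_⟩
    · intro t ht
      rw [Multiset.mem_cons, Multiset.mem_replicate] at ht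
      rcases ht with rfl | ⟨-, rfl⟩ <;> omega
    · intro t ht; rw [Multiset.mem_replicate] at ht; omega
    · rw [Multiset.card_cons, Multiset.card_replicate]; omega
    · rw [Multiset.card_replicate]; omega
    · rw [Multiset.card_cons, Multiset.card_replicate, Multiset.card_replicate]; omega
    · rw [Multiset.sum_cons, Multiset.sum_replicate, Multiset.sum_replicate, smul_eq_mul, smul_eq_mul,
        hS]
      have : min r (a - 1) + (r - min r (a - 1)) = r := by omega
      rw [add_assoc, ← Nat.add_mul, this, add_comm]

/-- **CASE I of the side-face case, numeric form (square cross-section)**: a tall profile with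
projection `p² + θ` (`1 ≤ θ ≤ p`), `u` top-class levels and surplus `S ≤ uθ` that fits on the
competitor's host levels, `S ≤ (p + k − 1 + e)θ`, obeys `9k⁴ + 6k² < 4p + 8k³ + 4k`.
[cite: MaininiPiovanoSchmidtStefanelli2019, §3 Steps 2–3] -/
theorem tall_quasicube_sideRows {p k e d n θ u S : ℕ} (hp : 1 ≤ p) (hk : 1 ≤ k)
    (hdp : d ≤ p ^ 2) (hkp : 3 * k ^ 2 * p + k ^ 3 ≤ (p + k) ^ 2) (hθ1 : 1 ≤ θ) (hθp : θ ≤ p)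
    (hSu : S ≤ u * θ) (hSH : S ≤ (p + k - 1 + e) * θ)
    (hn : n = (p + 3 * k + e) * p ^ 2 + S + d)
    (hopt : cubicEIP n = (p ^ 2 + θ) + (p + 3 * k + e) * (2 * p) + u + halfPerim d) :
    9 * k ^ 4 + 6 * k ^ 2 < 4 * p + 8 * k ^ 3 + 4 * k := by
  obtain ⟨s₁, s₂, h1, h2, hc1, hc2, hu, hsum⟩ :=
    exists_rows (a := p + k - 1) (b := e) hθ1 (by omega) hSu hSH
  rw [← hsum] at hn
  exact tall_quasicube_hosted hp hk hdp hkp hθ1 hθp h1 h2 hc1 hc2 hu hn hopt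

/-- **CASE I of the side-face case, numeric form (pronic cross-section)**.
[cite: MaininiPiovanoSchmidtStefanelli2019, §3 Steps 2–3] -/
theorem tall_quasicube_odd_sideRows {p k e d n θ u S : ℕ} (hp : 1 ≤ p) (hk : 1 ≤ k)
    (hdp : d ≤ p * (p + 1)) (hkp : 3 * p * k ^ 2 + k ^ 3 + k ^ 2 ≤ (p + k) * (p + k + 1) + p * k)
    (hθ1 : 1 ≤ θ) (hθp : θ ≤ p) (hSu : S ≤ u * θ) (hSH : S ≤ (p + k - 1 + e) * θ)
    (hn : n = (p + 3 * k + e) * (p * (p + 1)) + S + d)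
    (hopt : cubicEIP n = (p * (p + 1) + θ) + (p + 3 * k + e) * (2 * p + 1) + u + halfPerim d) :
    9 * k ^ 4 + 9 * k ^ 2 ≤ 4 * p + 14 * k ^ 3 + 4 * k := by
  obtain ⟨s₁, s₂, h1, h2, hc1, hc2, hu, hsum⟩ :=
    exists_rows (a := p + k - 1) (b := e) hθ1 (by omega) hSu hSH
  rw [← hsum] at hn
  exact tall_quasicube_odd_hosted hp hk hdp hkp hθp h1 h2 hc1 hc2 hu hn hopt

/-- **The Step-3 tail with slack `E` (square case)**: if the competitor comparison only gives
`2(p+k) ≤ 3k² + E + ⌈2√ρ₀⌉` (an overflow of cost `E`), one still gets a fourth-order bound,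
`(3k² + E + 1)² + 4k³ ≤ 4p(E + 1) + 12k³ + 4k(E + 1)`, i.e. `9k⁴ = O_E(p)`.
[cite: MaininiPiovanoSchmidtStefanelli2019, §3 Step 3 (eq. (3.11))] -/
theorem stepThree_tail_slack {p k ρ₀ E : ℕ} (hcase : 3 * k ^ 2 + E + 1 ≤ 2 * (p + k))
    (hρ₀ : ρ₀ + (3 * k ^ 2 * p + k ^ 3) = (p + k) ^ 2)
    (hkey : 2 * (p + k) ≤ 3 * k ^ 2 + E + halfPerim ρ₀) :
    (3 * k ^ 2 + E + 1) ^ 2 + 4 * k ^ 3 ≤ 4 * p * (E + 1) + 12 * k ^ 3 + 4 * k * (E + 1) := by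
  obtain ⟨t, ht⟩ : ∃ t, 2 * (p + k) = t + 3 * k ^ 2 + E + 1 :=
    ⟨2 * (p + k) - (3 * k ^ 2 + E + 1), by omega⟩
  have hlt : qsq t < ρ₀ := qsq_lt_of_lt_halfPerim (by omega)
  have hq := sq_le_four_mul_qsq_add_one t
  have h4 : t ^ 2 < 4 * ρ₀ + 1 := by omega
  have htZ : (t : ℤ) = 2 * ((p : ℤ) + k) - 3 * (k : ℤ) ^ 2 - E - 1 := by
    have h := congrArg (Nat.cast : ℕ → ℤ) ht
    push_cast at h
    linarith
  have h4Z : (t : ℤ) ^ 2 < 4 * (ρ₀ : ℤ) + 1 := by exact_mod_cast h4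
  have hρZ : (ρ₀ : ℤ) + (3 * (k : ℤ) ^ 2 * p + (k : ℤ) ^ 3) = ((p : ℤ) + k) ^ 2 := by
    exact_mod_cast hρ₀
  have ht2 : (t : ℤ) ^ 2 = 4 * ((p : ℤ) + k) ^ 2 - 4 * ((p : ℤ) + k) * (3 * (k : ℤ) ^ 2 + E + 1)
      + (3 * (k : ℤ) ^ 2 + E + 1) ^ 2 := by rw [htZ]; ring
  have goalZ : (3 * (k : ℤ) ^ 2 + E + 1) ^ 2 + 4 * (k : ℤ) ^ 3 ≤
      4 * (p : ℤ) * (E + 1) + 12 * (k : ℤ) ^ 3 + 4 * k * (E + 1) := by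
    nlinarith [ht2, h4Z, hρZ]
  exact_mod_cast goalZ

/-- **The Step-3 tail with slack `E` (pronic case)**:
`(3k² + E − 3k)² + 4k³ ≤ 4p(E + 1) + 4k` from `2p + 3k + 1 ≤ 3k² + E + ⌈2√ρ₀⌉`.
[cite: MaininiPiovanoSchmidtStefanelli2019, §3 Step 3 (eq. (3.11), s₂ = 1)] -/
theorem stepThree_tail_odd_slack {p k ρ₀ E : ℕ} (hk : 1 ≤ k) (hcase : 3 * k ^ 2 + E ≤ 2 * p + 3 * k)
    (hρ₀ : ρ₀ + (3 * p * k ^ 2 + k ^ 3 + k ^ 2) = (p + k) * (p + k + 1) + p * k)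
    (hkey : 2 * p + 3 * k + 1 ≤ 3 * k ^ 2 + E + halfPerim ρ₀) :
    (3 * k ^ 2 + E - 3 * k) ^ 2 + 4 * k ^ 3 ≤ 4 * p * (E + 1) + 4 * k := by
  obtain ⟨t, ht⟩ : ∃ t, 2 * p + 3 * k = t + 3 * k ^ 2 + E := ⟨2 * p + 3 * k - (3 * k ^ 2 + E), by omega⟩
  have hlt : qsq t < ρ₀ := qsq_lt_of_lt_halfPerim (by omega)
  have hq := sq_le_four_mul_qsq_add_one t
  have h4 : t ^ 2 < 4 * ρ₀ + 1 := by omega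
  have h3k : 3 * k ≤ 3 * k ^ 2 + E := by nlinarith
  obtain ⟨c₁, hc₁⟩ : ∃ c₁, 3 * k ^ 2 + E = c₁ + 3 * k := ⟨3 * k ^ 2 + E - 3 * k, by omega⟩
  rw [show 3 * k ^ 2 + E - 3 * k = c₁ by omega]
  have htZ : (t : ℤ) = 2 * (p : ℤ) - c₁ := by
    have h := congrArg (Nat.cast : ℕ → ℤ) ht
    have h' := congrArg (Nat.cast : ℕ → ℤ) hc₁
    push_cast at h h'
    linarith
  have h4Z : (t : ℤ) ^ 2 < 4 * (ρ₀ : ℤ) + 1 := by exact_mod_cast h4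
  have hρZ' : 4 * (ρ₀ : ℤ) = 4 * (p : ℤ) ^ 2 + 12 * ((p : ℤ) * k) + 4 * p + 4 * k
      - 12 * ((p : ℤ) * (k : ℤ) ^ 2) - 4 * (k : ℤ) ^ 3 := by
    have h := congrArg (Nat.cast : ℕ → ℤ) hρ₀
    push_cast at h
    linear_combination 4 * h
  have hc₁Z : (c₁ : ℤ) = 3 * (k : ℤ) ^ 2 + E - 3 * k := by
    have h' := congrArg (Nat.cast : ℕ → ℤ) hc₁
    push_cast at h'
    linarith
  have ht2 : (t : ℤ) ^ 2 = 4 * (p : ℤ) ^ 2 - 4 * (p : ℤ) * c₁ + (c₁ : ℤ) ^ 2 := by rw [htZ]; ring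
  have hpc : 4 * (p : ℤ) * c₁ = 12 * ((p : ℤ) * (k : ℤ) ^ 2) + 4 * (p : ℤ) * E - 12 * ((p : ℤ) * k) := by
    rw [hc₁Z]; ring
  have goalZ : (c₁ : ℤ) ^ 2 + 4 * (k : ℤ) ^ 3 ≤ 4 * (p : ℤ) * (E + 1) + 4 * k := by
    nlinarith [ht2, h4Z, hρZ', hpc]
  exact_mod_cast goalZ

end SideFaceRows

/-! ### CASE II of the side face (the `q(σ+1)`-view) and the side-face arithmetic -/

section SideFaceShrunk

/-- **`G₃` against a competitor of LARGER volume**: if `n ≤ Σ μ` and all levels of `μ` are `≤ B`,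
then `G₃(n) ≤ B + Σ_{a ∈ μ} ⌈2√a⌉` — shrink the levels one point at a time (`⌈2√·⌉` is monotone)
down to volume `n` and apply `cubicEIP_multisetSum_le_of_le`.
[cite: MaininiPiovanoSchmidtStefanelli2019, §2.2 (EIP_n as a minimum over configurations)] -/
theorem cubicEIP_le_of_le_multisetSum {μ : Multiset ℕ} {B n : ℕ} (hn : n ≤ μ.sum)
    (hle : ∀ a ∈ μ, a ≤ B) : cubicEIP n ≤ B + (μ.map halfPerim).sum := by
  classical
  obtain ⟨r, hr⟩ : ∃ r, μ.sum = n + r := ⟨μ.sum - n, by omega⟩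
  clear hn
  induction r generalizing μ with
  | zero =>
    rw [add_zero] at hr
    rw [← hr]
    exact cubicEIP_multisetSum_le_of_le hle
  | succ r ih =>
    have hex : ∃ a ∈ μ, 0 < a := by
      by_contra h
      push Not at h
      have : μ.sum = 0 := Multiset.sum_eq_zero fun a ha => Nat.le_zero.1 (h a ha)
      omega
    obtain ⟨a, ha, ha0⟩ := hex
    have hμ : μ = a ::ₘ μ.erase a := (Multiset.cons_erase ha).symm
    have hsum : μ.sum = a + (μ.erase a).sum := by
      conv_lhs => rw [hμ]
      exact Multiset.sum_cons _ _
    have hmapμ : (μ.map halfPerim).sum = halfPerim a + ((μ.erase a).map halfPerim).sum := by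
      conv_lhs => rw [hμ]
      rw [Multiset.map_cons, Multiset.sum_cons]
    set μ' : Multiset ℕ := (a - 1) ::ₘ μ.erase a with hμ'
    have hsum' : μ'.sum = n + r := by
      rw [hμ', Multiset.sum_cons]
      omega
    have hle' : ∀ b ∈ μ', b ≤ B := by
      intro b hb
      rw [hμ', Multiset.mem_cons] at hb
      rcases hb with rfl | hb
      · exact (Nat.sub_le a 1).trans (hle a ha)
      · exact hle b (Multiset.mem_of_mem_erase hb)
    have hmap : (μ'.map halfPerim).sum ≤ (μ.map halfPerim).sum := by
      rw [hmapμ, hμ', Multiset.map_cons, Multiset.sum_cons]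
      exact Nat.add_le_add_right (halfPerim_mono (Nat.sub_le a 1)) _
    exact (ih hle' hsum').trans (Nat.add_le_add_left hmap _)

/-- **`G₃ = EIP³/2` is monotone** (`n ↦ min {#Θ₃(C) : #C = n}/2` is non-decreasing: shrink the
levels of a minimizer). [cite: MaininiPiovanoSchmidtStefanelli2019, §2.2] -/
theorem cubicEIP_mono : Monotone cubicEIP := by
  intro a b hab
  rcases Nat.eq_zero_or_pos b with hb0 | hbpos
  · subst hb0
    rw [Nat.le_zero.1 hab]
  obtain ⟨C, hCb, hC⟩ := exists_card_boundaryPairs_eq_two_mul_cubicEIP b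
  have hmin : IsEIPMinimizer C := (isEIPMinimizer_iff_card_boundaryPairs_eq_three C).2 (hCb ▸ hC)
  have hne : C.Nonempty := card_pos.1 (by omega)
  obtain ⟨μ, hμ, -, hsum⟩ := hmin.isOptimalLevels hne 0
  have h := cubicEIP_le_of_le_multisetSum (μ := μ) (n := a) (by omega) hμ.le
  rw [hμ.cost_eq, hsum, hCb] at h
  exact h

/-- The degenerate square configuration `2(p + k) ≤ 3k² + 1` contradicts the admissibility
`3k²p + k³ ≤ (p+k)²` for `k ≥ 2`. [cite: MaininiPiovanoSchmidtStefanelli2019, §3 Step 3] -/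
private theorem sideFace_degenerate_sq {p k : ℕ} (hk2 : 2 ≤ k) (hcase : 2 * (p + k) ≤ 3 * k ^ 2 + 1)
    (hkp : 3 * k ^ 2 * p + k ^ 3 ≤ (p + k) ^ 2) : False := by
  have h1 : p * (2 * (p + k)) ≤ p * (3 * k ^ 2 + 1) := Nat.mul_le_mul_left p hcase
  have h2 : k ^ 2 * 2 ≤ k ^ 2 * k := Nat.mul_le_mul_left _ hk2
  have hkk : 2 * k ≤ k * k := by nlinarith
  have h3 : p * (2 * k + 1) ≤ p * (3 * k ^ 2) := Nat.mul_le_mul_left p (by nlinarith)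
  nlinarith [h1, h2, h3, hkp]

/-- The arithmetic tail of [MPSS19] §3 Step 3, square cross-section: from
`2(p+k) ≤ 3k² + ⌈2√ρ₀⌉` with `ρ₀ = (p+k)² − 3k²p − k³` to `9k⁴ + 6k² < 4p + 8k³ + 4k`.
[cite: MaininiPiovanoSchmidtStefanelli2019, §3 Step 3 (eq. (3.11))] -/
private theorem sideFace_tail_sq {p k ρ₀ : ℕ} (hp : 1 ≤ p) (hk : 1 ≤ k)
    (hkp : 3 * k ^ 2 * p + k ^ 3 ≤ (p + k) ^ 2) (hρ₀ : ρ₀ + (3 * k ^ 2 * p + k ^ 3) = (p + k) ^ 2)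
    (hkey : 2 * (p + k) ≤ 3 * k ^ 2 + halfPerim ρ₀) :
    9 * k ^ 4 + 6 * k ^ 2 < 4 * p + 8 * k ^ 3 + 4 * k := by
  rcases Nat.lt_or_ge (3 * k ^ 2 + 1) (2 * (p + k)) with hcase | hcase
  · have h := stepThree_tail_slack (E := 0) (by omega) hρ₀ (by simpa using hkey)
    have e : (3 * k ^ 2 + 0 + 1) ^ 2 = 9 * k ^ 4 + 6 * k ^ 2 + 1 := by ring
    rw [e] at h
    omega
  · rcases Nat.lt_or_ge k 2 with hk1 | hk2
    · have hk1' : k = 1 := by omega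
      subst hk1'
      have hp1 : p = 1 := by omega
      subst hp1
      norm_num
    · exact (sideFace_degenerate_sq hk2 hcase hkp).elim

/-- The degenerate pronic configuration `2p + 3k + 1 ≤ 3k²` contradicts the admissibility
`3pk² + k³ + k² ≤ (p+k)(p+k+1) + pk`. [cite: MaininiPiovanoSchmidtStefanelli2019, §3 Step 3] -/
private theorem sideFace_degenerate_pronic {p k : ℕ} (hp : 1 ≤ p) (hk : 1 ≤ k)
    (hcase : 2 * p + 3 * k + 1 ≤ 3 * k ^ 2)
    (hkp : 3 * p * k ^ 2 + k ^ 3 + k ^ 2 ≤ (p + k) * (p + k + 1) + p * k) : False := by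
  rcases Nat.lt_or_ge k 2 with hk1 | hk2
  · have hk1' : k = 1 := by omega
    subst hk1'
    omega
  · have h1 : p * (2 * p + 3 * k + 1) ≤ p * (3 * k ^ 2) := Nat.mul_le_mul_left p hcase
    have h2 : k ^ 2 * 2 ≤ k ^ 2 * k := Nat.mul_le_mul_left _ hk2
    have h3 : 1 * k ≤ k * k := Nat.mul_le_mul_right k hk
    nlinarith [h1, h2, h3, hkp]

/-- The arithmetic tail of [MPSS19] §3 Step 3, pronic cross-section: from
`2p + 3k + 1 ≤ 3k² + ⌈2√ρ₀⌉` with `ρ₀ = (p+k)(p+k+1) + pk − 3pk² − k³ − k²` to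
`9k⁴ + 9k² ≤ 4p + 14k³ + 4k`. [cite: MaininiPiovanoSchmidtStefanelli2019, §3 Step 3 (eq. (3.11), s₂ = 1)] -/
private theorem sideFace_tail_pronic {p k ρ₀ : ℕ} (hp : 1 ≤ p) (hk : 1 ≤ k)
    (hkp : 3 * p * k ^ 2 + k ^ 3 + k ^ 2 ≤ (p + k) * (p + k + 1) + p * k)
    (hρ₀ : ρ₀ + (3 * p * k ^ 2 + k ^ 3 + k ^ 2) = (p + k) * (p + k + 1) + p * k)
    (hkey : 2 * p + 3 * k + 1 ≤ 3 * k ^ 2 + halfPerim ρ₀) :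
    9 * k ^ 4 + 9 * k ^ 2 ≤ 4 * p + 14 * k ^ 3 + 4 * k := by
  rcases Nat.lt_or_ge (3 * k ^ 2) (2 * p + 3 * k + 1) with hcase | hcase
  · obtain ⟨t, ht⟩ : ∃ t, 2 * p + 3 * k = t + 3 * k ^ 2 := ⟨2 * p + 3 * k - 3 * k ^ 2, by omega⟩
    have hlt : qsq t < ρ₀ := qsq_lt_of_lt_halfPerim (by omega)
    have hq := sq_le_four_mul_qsq_add_one t
    have h4 : t ^ 2 < 4 * ρ₀ + 1 := by omega
    have htZ : (t : ℤ) = 2 * (p : ℤ) + 3 * k - 3 * (k : ℤ) ^ 2 := by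
      have h := congrArg (Nat.cast : ℕ → ℤ) ht
      push_cast at h
      linarith
    have h4Z : (t : ℤ) ^ 2 < 4 * (ρ₀ : ℤ) + 1 := by exact_mod_cast h4
    have hρZ : (ρ₀ : ℤ) + (3 * (p : ℤ) * (k : ℤ) ^ 2 + (k : ℤ) ^ 3 + (k : ℤ) ^ 2) =
        ((p : ℤ) + k) * ((p : ℤ) + k + 1) + p * k := by
      exact_mod_cast hρ₀
    have ht2 : (t : ℤ) ^ 2 = 4 * (p : ℤ) ^ 2 + 9 * (k : ℤ) ^ 2 + 9 * (k : ℤ) ^ 4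
        + 12 * ((p : ℤ) * k) - 12 * ((p : ℤ) * (k : ℤ) ^ 2) - 18 * (k : ℤ) ^ 3 := by
      rw [htZ]; ring
    have hρZ' : 4 * (ρ₀ : ℤ) = 4 * (p : ℤ) ^ 2 + 12 * ((p : ℤ) * k) + 4 * p + 4 * k
        - 12 * ((p : ℤ) * (k : ℤ) ^ 2) - 4 * (k : ℤ) ^ 3 := by
      linear_combination 4 * hρZ
    have goalZ : 9 * (k : ℤ) ^ 4 + 9 * (k : ℤ) ^ 2 ≤ 4 * p + 14 * (k : ℤ) ^ 3 + 4 * k := by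
      linarith [ht2, hρZ', h4Z]
    exact_mod_cast goalZ
  · exact (sideFace_degenerate_pronic hp hk hcase hkp).elim

/-- **Step 3 in the `q(σ+1)`-view, square cross-section `p × p` (CASE II of the side face).**
The tall profile "`c − 1 = p + 3k + e` levels, `u` of them top-class with projection
`M = p² + θ` (`θ ≤ p`) and surplus `S ≤ uθ`, `w = c − 1 − u ≤ e` plain levels `p²`, top level
`d ≤ M`" is read as the pronic box `p(p+1) × (c − 1)` with MISSING points; its cost
`M + (c−1)·2p + u + ⌈2√d⌉` equals `[p(p+1) + (c−1)(2p+1) + ⌈2√d⌉] − (p − θ) − w`.  The competitor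
is the Step-3 rearrangement of that pronic box (`p + k − 1` levels `(p+k)(p+k+1)`, one deficient
level, `e` spare levels, the top level) with `p − θ` points removed from every big level (the
maximum drops by `p − θ`) and `w` spare levels shrunk to `p²` (one unit each); when
`u + 1 ≥ p + k` its volume is at least `n`, so by the monotone competitor bound
`cubicEIP_le_of_le_multisetSum` the pronic Step-3 inequality `2p + 3k + 1 ≤ 3k² + ⌈2√ρ₀⌉`
survives verbatim: `9k⁴ + 9k² ≤ 4p + 14k³ + 4k`.
[cite: MaininiPiovanoSchmidtStefanelli2019, §3 Steps 2–3 (side face F², eqs. (3.7)–(3.11))] -/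
theorem tall_quasicube_shrunk {p k e d n θ u w S : ℕ} (hp : 1 ≤ p) (hk : 1 ≤ k)
    (hdp : d ≤ p ^ 2 + θ)
    (hkp : 3 * p * k ^ 2 + k ^ 3 + k ^ 2 ≤ (p + k) * (p + k + 1) + p * k) (hθp : θ ≤ p)
    (hwe : w ≤ e) (hwu : u + w = p + 3 * k + e) (hSu : S ≤ u * θ) (hupk : p + k ≤ u + 1)
    (hn : n = (p + 3 * k + e) * p ^ 2 + S + d)
    (hopt : cubicEIP n = (p ^ 2 + θ) + (p + 3 * k + e) * (2 * p) + u + halfPerim d) :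
    9 * k ^ 4 + 9 * k ^ 2 ≤ 4 * p + 14 * k ^ 3 + 4 * k := by
  classical
  obtain ⟨j, hj⟩ : ∃ j, p + k = j + 1 := ⟨p + k - 1, by omega⟩
  obtain ⟨δ₀, hδ₀⟩ : ∃ δ₀, θ + δ₀ = p := ⟨p - θ, by omega⟩
  obtain ⟨ρ₀, hρ₀⟩ : ∃ ρ₀, ρ₀ + (3 * p * k ^ 2 + k ^ 3 + k ^ 2) = (p + k) * (p + k + 1) + p * k :=
    ⟨(p + k) * (p + k + 1) + p * k - (3 * p * k ^ 2 + k ^ 3 + k ^ 2), Nat.sub_add_cancel hkp⟩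
  have i2 : (p + k) * (p + k + 1) = p * (p + 1) + 2 * (p * k) + k ^ 2 + k := by ring
  have i4 : p * (p + 1) = p ^ 2 + p := by ring
  have hpk : p ≤ p * k := Nat.le_mul_of_pos_right p hk
  have hδQ : δ₀ ≤ (p + k) * (p + k + 1) := by rw [i2, i4]; omega
  obtain ⟨B', hB'⟩ : ∃ B', B' + δ₀ = (p + k) * (p + k + 1) :=
    ⟨(p + k) * (p + k + 1) - δ₀, Nat.sub_add_cancel hδQ⟩
  -- competitor: `j` big levels `B' = (p+k)(p+k+1) − δ₀`, the deficient level `ρ₀`,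
  -- `e − w` spare levels `p(p+1)`, `w` shrunk spare levels `p²`, the top level `d`
  set μ : Multiset ℕ :=
    Multiset.replicate j B' + Multiset.replicate (e - w) (p * (p + 1)) +
      Multiset.replicate w (p ^ 2) + {ρ₀, d} with hμ
  have hρB : ρ₀ ≤ B' := by
    have h1 : p * k ≤ p * k ^ 2 := Nat.mul_le_mul_left p (by nlinarith)
    have h2 : 3 * p * k ^ 2 = 3 * (p * k ^ 2) := by ring
    omega
  have hQB : p * (p + 1) ≤ B' := by omega
  have hpQ : p ^ 2 ≤ p * (p + 1) := by omega
  have hμle : ∀ a ∈ μ, a ≤ B' := by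
    intro a ha
    rw [hμ, Multiset.mem_add, Multiset.mem_add, Multiset.mem_add, Multiset.mem_replicate,
      Multiset.mem_replicate, Multiset.mem_replicate, Multiset.insert_eq_cons, Multiset.mem_cons,
      Multiset.mem_singleton] at ha
    rcases ha with ((⟨-, rfl⟩ | ⟨-, rfl⟩) | ⟨-, rfl⟩) | rfl | rfl
    · exact le_rfl
    · exact hQB
    · exact hpQ.trans hQB
    · exact hρB
    · omega
  -- volume: `Σ μ + j δ₀ = (c−1) p² + u p + d ≥ n + j δ₀`
  have e1 : (p + 3 * k) * (p * (p + 1)) + (3 * p * k ^ 2 + k ^ 3 + k ^ 2) =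
      (p + k) * ((p + k) * (p + k + 1)) + p * k := by ring
  have e2 : (p + k) * ((p + k) * (p + k + 1)) =
      j * ((p + k) * (p + k + 1)) + (p + k) * (p + k + 1) := by rw [hj]; ring
  have f1 : j * B' + j * δ₀ = j * ((p + k) * (p + k + 1)) := by rw [← Nat.mul_add, hB']
  have f3 : (e - w) * (p * (p + 1)) + w * (p * (p + 1)) = e * (p * (p + 1)) := by
    rw [← Nat.add_mul, Nat.sub_add_cancel hwe]
  have f4 : w * (p * (p + 1)) = w * p ^ 2 + w * p := by ring
  have f5 : (p + 3 * k + e) * (p * (p + 1)) =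
      (p + 3 * k) * (p * (p + 1)) + e * (p * (p + 1)) := by ring
  have f6 : (p + 3 * k + e) * (p * (p + 1)) = (p + 3 * k + e) * p ^ 2 + (p + 3 * k + e) * p := by
    ring
  have f7 : u * p + w * p = (p + 3 * k + e) * p := by rw [← Nat.add_mul, hwu]
  have f8 : u * p = u * θ + u * δ₀ := by rw [← hδ₀, Nat.mul_add]
  have f9 : j * δ₀ ≤ u * δ₀ := Nat.mul_le_mul_right δ₀ (by omega)
  have hμsum : μ.sum = j * B' + (e - w) * (p * (p + 1)) + w * p ^ 2 + (ρ₀ + d) := by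
    rw [hμ, Multiset.sum_add, Multiset.sum_add, Multiset.sum_add, Multiset.sum_replicate,
      Multiset.sum_replicate, Multiset.sum_replicate, Multiset.insert_eq_cons, Multiset.sum_cons,
      Multiset.sum_singleton, smul_eq_mul, smul_eq_mul, smul_eq_mul]
  have hnle : n ≤ μ.sum := by rw [hμsum, hn]; omega
  -- cost
  have hgB : halfPerim B' ≤ 2 * (p + k) + 1 :=
    halfPerim_le_iff.2 (by rw [qsq_two_mul_add_one]; omega)
  have g1 : j * halfPerim B' ≤ j * (2 * (p + k) + 1) := Nat.mul_le_mul_left j hgB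
  have hμg : (μ.map halfPerim).sum =
      j * halfPerim B' + (e - w) * (2 * p + 1) + w * (2 * p) + (halfPerim ρ₀ + halfPerim d) := by
    rw [hμ, Multiset.map_add, Multiset.map_add, Multiset.map_add, Multiset.sum_add,
      Multiset.sum_add, Multiset.sum_add, Multiset.map_replicate, Multiset.map_replicate,
      Multiset.map_replicate, Multiset.sum_replicate, Multiset.sum_replicate,
      Multiset.sum_replicate, Multiset.insert_eq_cons, Multiset.map_cons, Multiset.sum_cons,
      Multiset.map_singleton, Multiset.sum_singleton, smul_eq_mul, smul_eq_mul, smul_eq_mul,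
      halfPerim_mul_succ (k := p) hp, halfPerim_sq (k := p) hp]
  have hcomp := cubicEIP_le_of_le_multisetSum hnle hμle
  rw [hμg, hopt] at hcomp
  -- bookkeeping: the maximum pays `−δ₀`, the shrunk levels `−w`; the rest is Step 3 (pronic)
  have s1 : (e - w) * (2 * p + 1) + w * (2 * p + 1) = e * (2 * p + 1) := by
    rw [← Nat.add_mul, Nat.sub_add_cancel hwe]
  have s2 : w * (2 * p + 1) = w * (2 * p) + w := by ring
  have s3 : e * (2 * p + 1) = e * (2 * p) + e := by ring
  have i1 : j * (2 * (p + k) + 1) + (2 * (p + k) + 1) =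
      2 * p ^ 2 + 4 * (p * k) + 2 * k ^ 2 + p + k := by
    have : j * (2 * (p + k) + 1) + (2 * (p + k) + 1) = (p + k) * (2 * (p + k) + 1) := by
      rw [hj]; ring
    rw [this]; ring
  have i3 : (p + 3 * k + e) * (2 * p) = 2 * p ^ 2 + 6 * (p * k) + e * (2 * p) := by ring
  have hkey : 2 * p + 3 * k + 1 ≤ 3 * k ^ 2 + halfPerim ρ₀ := by omega
  exact sideFace_tail_pronic hp hk hkp hρ₀ hkey

/-- **Step 3 in the `q(σ+1)`-view, pronic cross-section `p × (p+1)` (CASE II of the side face,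
`σ` odd).**  The tall profile "`c − 1 = (p + 1) + 3k + e` levels, `u` of them top-class with
projection `M = p(p+1) + θ` (`θ ≤ p + 1`) and surplus `S ≤ uθ`, `w = c − 1 − u ≤ e` plain levels
`p(p+1)`, top level `d ≤ M`" is read as the square box `(p+1)² × (c − 1)` with missing points
(cost `[(p+1)² + (c−1)(2p+2) + ⌈2√d⌉] − (p + 1 − θ) − w`); the competitor is the Step-3
rearrangement of that square box with `p + 1 − θ` points removed from every big level and `w`
spare levels shrunk to `p(p+1)`; for `u ≥ p + k` its volume is at least `n`, and the square
Step-3 inequality for `p + 1` survives: `9k⁴ + 6k² < 4(p+1) + 8k³ + 4k`.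
[cite: MaininiPiovanoSchmidtStefanelli2019, §3 Steps 2–3 (side face F², eqs. (3.7)–(3.11))] -/
theorem tall_quasicube_odd_shrunk {p k e d n θ u w S : ℕ} (hp : 1 ≤ p) (hk : 1 ≤ k)
    (hdp : d ≤ p * (p + 1) + θ) (hkp : 3 * k ^ 2 * (p + 1) + k ^ 3 ≤ (p + 1 + k) ^ 2)
    (hθp : θ ≤ p + 1) (hwe : w ≤ e) (hwu : u + w = p + 1 + 3 * k + e) (hSu : S ≤ u * θ)
    (hupk : p + k ≤ u) (hn : n = (p + 1 + 3 * k + e) * (p * (p + 1)) + S + d)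
    (hopt : cubicEIP n = (p * (p + 1) + θ) + (p + 1 + 3 * k + e) * (2 * p + 1) + u + halfPerim d) :
    9 * k ^ 4 + 6 * k ^ 2 < 4 * (p + 1) + 8 * k ^ 3 + 4 * k := by
  classical
  set j := p + k with hjdef
  have hj : p + 1 + k = j + 1 := by rw [hjdef]; ring
  obtain ⟨δ₀, hδ₀⟩ : ∃ δ₀, θ + δ₀ = p + 1 := ⟨p + 1 - θ, by omega⟩
  obtain ⟨ρ₀, hρ₀⟩ : ∃ ρ₀, ρ₀ + (3 * k ^ 2 * (p + 1) + k ^ 3) = (p + 1 + k) ^ 2 :=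
    ⟨(p + 1 + k) ^ 2 - (3 * k ^ 2 * (p + 1) + k ^ 3), Nat.sub_add_cancel hkp⟩
  have i2 : (p + 1 + k) ^ 2 = p * (p + 1) + 2 * (p * k) + k ^ 2 + p + 2 * k + 1 := by ring
  have hδQ : δ₀ ≤ (p + 1 + k) ^ 2 := by rw [i2]; omega
  obtain ⟨B', hB'⟩ : ∃ B', B' + δ₀ = (p + 1 + k) ^ 2 :=
    ⟨(p + 1 + k) ^ 2 - δ₀, Nat.sub_add_cancel hδQ⟩
  -- competitor: `j = p + k` big levels `B' = (p+1+k)² − δ₀`, the deficient level `ρ₀`,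
  -- `e − w` spare levels `(p+1)²`, `w` shrunk spare levels `p(p+1)`, the top level `d`
  set μ : Multiset ℕ :=
    Multiset.replicate j B' + Multiset.replicate (e - w) ((p + 1) ^ 2) +
      Multiset.replicate w (p * (p + 1)) + {ρ₀, d} with hμ
  have i5 : (p + 1) ^ 2 = p * (p + 1) + (p + 1) := by ring
  have hρB : ρ₀ ≤ B' := by
    have h1 : 3 * (p + 1) ≤ 3 * k ^ 2 * (p + 1) := by
      have : 1 * (p + 1) ≤ k ^ 2 * (p + 1) := Nat.mul_le_mul_right _ (by nlinarith)
      nlinarith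
    omega
  have hQB : (p + 1) ^ 2 ≤ B' := by
    have hpk : p + 1 ≤ (p + 1) * k := Nat.le_mul_of_pos_right _ hk
    have : (p + 1) * k = p * k + k := by ring
    omega
  have hpQ : p * (p + 1) ≤ (p + 1) ^ 2 := by omega
  have hμle : ∀ a ∈ μ, a ≤ B' := by
    intro a ha
    rw [hμ, Multiset.mem_add, Multiset.mem_add, Multiset.mem_add, Multiset.mem_replicate,
      Multiset.mem_replicate, Multiset.mem_replicate, Multiset.insert_eq_cons, Multiset.mem_cons,
      Multiset.mem_singleton] at ha
    rcases ha with ((⟨-, rfl⟩ | ⟨-, rfl⟩) | ⟨-, rfl⟩) | rfl | rfl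
    · exact le_rfl
    · exact hQB
    · exact hpQ.trans hQB
    · exact hρB
    · omega
  -- volume: `Σ μ + j δ₀ = (c−1) p(p+1) + u (p+1) + d ≥ n + j δ₀`
  have e1 : (p + 1 + 3 * k) * (p + 1) ^ 2 + (3 * k ^ 2 * (p + 1) + k ^ 3) =
      (p + 1 + k) * (p + 1 + k) ^ 2 := by ring
  have e2 : (p + 1 + k) * (p + 1 + k) ^ 2 = j * (p + 1 + k) ^ 2 + (p + 1 + k) ^ 2 := by
    rw [hj]; ring
  have f1 : j * B' + j * δ₀ = j * (p + 1 + k) ^ 2 := by rw [← Nat.mul_add, hB']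
  have f3 : (e - w) * (p + 1) ^ 2 + w * (p + 1) ^ 2 = e * (p + 1) ^ 2 := by
    rw [← Nat.add_mul, Nat.sub_add_cancel hwe]
  have f4 : w * (p + 1) ^ 2 = w * (p * (p + 1)) + w * (p + 1) := by ring
  have f5 : (p + 1 + 3 * k + e) * (p + 1) ^ 2 =
      (p + 1 + 3 * k) * (p + 1) ^ 2 + e * (p + 1) ^ 2 := by ring
  have f6 : (p + 1 + 3 * k + e) * (p + 1) ^ 2 =
      (p + 1 + 3 * k + e) * (p * (p + 1)) + (p + 1 + 3 * k + e) * (p + 1) := by ring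
  have f7 : u * (p + 1) + w * (p + 1) = (p + 1 + 3 * k + e) * (p + 1) := by rw [← Nat.add_mul, hwu]
  have f8 : u * (p + 1) = u * θ + u * δ₀ := by rw [← hδ₀, Nat.mul_add]
  have f9 : j * δ₀ ≤ u * δ₀ := Nat.mul_le_mul_right δ₀ (by omega)
  have hμsum : μ.sum = j * B' + (e - w) * (p + 1) ^ 2 + w * (p * (p + 1)) + (ρ₀ + d) := by
    rw [hμ, Multiset.sum_add, Multiset.sum_add, Multiset.sum_add, Multiset.sum_replicate,
      Multiset.sum_replicate, Multiset.sum_replicate, Multiset.insert_eq_cons, Multiset.sum_cons,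
      Multiset.sum_singleton, smul_eq_mul, smul_eq_mul, smul_eq_mul]
  have hnle : n ≤ μ.sum := by rw [hμsum, hn]; omega
  -- cost
  have hgB : halfPerim B' ≤ 2 * (p + 1 + k) := halfPerim_le_iff.2 (by rw [qsq_two_mul]; omega)
  have g1 : j * halfPerim B' ≤ j * (2 * (p + 1 + k)) := Nat.mul_le_mul_left j hgB
  have hμg : (μ.map halfPerim).sum =
      j * halfPerim B' + (e - w) * (2 * (p + 1)) + w * (2 * p + 1) +
        (halfPerim ρ₀ + halfPerim d) := by
    rw [hμ, Multiset.map_add, Multiset.map_add, Multiset.map_add, Multiset.sum_add,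
      Multiset.sum_add, Multiset.sum_add, Multiset.map_replicate, Multiset.map_replicate,
      Multiset.map_replicate, Multiset.sum_replicate, Multiset.sum_replicate,
      Multiset.sum_replicate, Multiset.insert_eq_cons, Multiset.map_cons, Multiset.sum_cons,
      Multiset.map_singleton, Multiset.sum_singleton, smul_eq_mul, smul_eq_mul, smul_eq_mul,
      halfPerim_sq (k := p + 1) (by omega), halfPerim_mul_succ (k := p) hp]
  have hcomp := cubicEIP_le_of_le_multisetSum hnle hμle
  rw [hμg, hopt] at hcomp
  -- bookkeeping: the maximum pays `−δ₀`, the shrunk levels `−w`; the rest is Step 3 (square, p+1)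
  have s1 : (e - w) * (2 * (p + 1)) + w * (2 * (p + 1)) = e * (2 * (p + 1)) := by
    rw [← Nat.add_mul, Nat.sub_add_cancel hwe]
  have s2 : w * (2 * (p + 1)) = w * (2 * p + 1) + w := by ring
  have s3 : e * (2 * (p + 1)) = e * (2 * p + 1) + e := by ring
  have i1 : j * (2 * (p + 1 + k)) + 2 * (p + 1 + k) = 2 * (p + 1 + k) ^ 2 := by rw [hj]; ring
  have i3 : (p + 1 + 3 * k + e) * (2 * p + 1) =
      2 * (p * (p + 1)) + p + 1 + 6 * (p * k) + 3 * k + e * (2 * p + 1) := by ring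
  have hkey : 2 * (p + 1 + k) ≤ 3 * k ^ 2 + halfPerim ρ₀ := by omega
  exact sideFace_tail_sq (p := p + 1) (by omega) hk hkp hρ₀ hkey

/-- **From the Step-3 inequalities to the height bound** (pure arithmetic, [MPSS19] §3 Step 4 in
profile language): if every `k ≥ 1` with `6k ≤ h` and `k² ≤ p/3` satisfies
`9k⁴ ≤ 4p + 14k³ + 4k + 3`, then `h⁴ ≤ 58564·p` (`p ≥ 27`; take `k = min(⌊h/6⌋, ⌊√(p/3)⌋)`).
[cite: MaininiPiovanoSchmidtStefanelli2019, §3 Steps 3–4 (ℓ₃ − ℓ ≤ √6 α^{1/4} ℓ^{1/4} + o(ℓ^{1/4}))] -/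
private theorem height_pow_four_le {p h : ℕ} (hp : 27 ≤ p)
    (use : ∀ k : ℕ, 1 ≤ k → 6 * k ≤ h → k ^ 2 ≤ p / 3 →
      9 * k ^ 4 ≤ 4 * p + 14 * k ^ 3 + 4 * k + 3) :
    h ^ 4 ≤ 58564 * p := by
  set k₁ := Nat.sqrt (p / 3) with hk₁
  have hk₁sq : k₁ ^ 2 ≤ p / 3 := Nat.sqrt_le' _
  have hk₁lt : p / 3 < (k₁ + 1) ^ 2 := Nat.lt_succ_sqrt' _
  have hk₁3 : 3 ≤ k₁ := by rw [hk₁]; apply Nat.le_sqrt.2; omega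
  rcases Nat.lt_or_ge (h / 6) (k₁ + 1) with hsmall | hbig
  · -- `k = ⌊h/6⌋ ≤ k₁`
    rcases Nat.lt_or_ge h 6 with h6 | h6
    · calc h ^ 4 ≤ 6 ^ 4 := Nat.pow_le_pow_left h6.le 4
        _ ≤ 58564 * p := by omega
    set k := h / 6 with hk
    have hk1 : 1 ≤ k := by omega
    have hkk₁ : k ≤ k₁ := by omega
    have hb := use k hk1 (by omega) ((Nat.pow_le_pow_left hkk₁ 2).trans hk₁sq)
    have hk4 : k ^ 4 ≤ 4 * p := by
      rcases Nat.lt_or_ge k 2 with hk2 | hk2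
      · have hk1' : k = 1 := by omega
        rw [hk1']; omega
      · have e4 : k ^ 4 = k ^ 3 * k := by ring
        have h3 : k ^ 3 * 2 ≤ k ^ 3 * k := Nat.mul_le_mul_left _ hk2
        have h8 : 2 ^ 3 ≤ k ^ 3 := Nat.pow_le_pow_left hk2 3
        have h8k : 8 * k ≤ k ^ 3 * k := by
          have := Nat.mul_le_mul_right k h8; linarith
        omega
    have hh : h ≤ 11 * k := by omega
    calc h ^ 4 ≤ (11 * k) ^ 4 := Nat.pow_le_pow_left hh 4
      _ = 14641 * k ^ 4 := by ring
      _ ≤ 58564 * p := by omega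
  · -- `k = k₁ < ⌊h/6⌋`: the Step-3 inequality contradicts `p < 3(k₁ + 1)² + 3` for `k₁ ≥ 3`
    exfalso
    have hb := use k₁ (by omega) (by omega) hk₁sq
    have isq : (k₁ + 1) ^ 2 = k₁ ^ 2 + 2 * k₁ + 1 := by ring
    have hp' : p < 3 * k₁ ^ 2 + 6 * k₁ + 6 := by omega
    have i2 : 3 * k₁ ≤ k₁ ^ 2 := by nlinarith
    have i3 : 3 * k₁ ^ 2 ≤ k₁ ^ 3 := by
      have : k₁ ^ 2 * 3 ≤ k₁ ^ 2 * k₁ := Nat.mul_le_mul_left _ hk₁3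
      nlinarith
    have i4 : 3 * k₁ ^ 3 ≤ k₁ ^ 4 := by
      have : k₁ ^ 3 * 3 ≤ k₁ ^ 3 * k₁ := Nat.mul_le_mul_left _ hk₁3
      nlinarith
    omega

/-- **The side-face arithmetic, square cross-section (`σ = 2p`), top level inside the box**
(`d ≤ p²`): an optimal side-face profile with `c − 1` levels, projection `p² + θ`
(`1 ≤ θ ≤ p − 1`), `u` top-class levels with surplus `S ≤ uθ`, has height excess
`(c − 1 − p)⁴ ≤ 58564·p` once `p ≥ 27`.  For each admissible `k` either the surplus fits on the
`c − 2 − 2k` host levels of the Step-3 competitor (CASE I, `tall_quasicube_sideRows`) or all but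
`≤ 2k` levels are top-class and the `q(σ+1)`-view competitor applies (CASE II,
`tall_quasicube_shrunk`); both give `9k⁴ = O(p)`.
[cite: MaininiPiovanoSchmidtStefanelli2019, §3 Steps 2–4] -/
private theorem sideFace_sq_core {p c d n θ u S : ℕ} (hp : 27 ≤ p) (hθ1 : 1 ≤ θ)
    (hθp : θ + 1 ≤ p) (huc : u + 1 ≤ c) (hdp : d ≤ p ^ 2) (hSu : S ≤ u * θ)
    (hn : n = (c - 1) * p ^ 2 + S + d)
    (hopt : cubicEIP n = (p ^ 2 + θ) + (c - 1) * (2 * p) + u + halfPerim d) :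
    (c - 1 - p) ^ 4 ≤ 58564 * p := by
  rcases Nat.lt_or_ge (c - 1) p with hlt | hge
  · rw [show c - 1 - p = 0 by omega]; simp
  obtain ⟨h, hh⟩ : ∃ h, c - 1 = p + h := ⟨c - 1 - p, by omega⟩
  rw [show c - 1 - p = h by omega]
  rw [hh] at hn hopt
  refine height_pow_four_le hp fun k hk1 hkh hk2 => ?_
  -- admissibility of `k` (for `p`, both cross-section shapes) from `3k² ≤ p`
  have h3 : 3 * k ^ 2 ≤ p := by omega
  have hkk : k ≤ k ^ 2 := by nlinarith
  have h4 : k ^ 3 ≤ 2 * p * k := by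
    calc k ^ 3 = k ^ 2 * k := by ring
      _ ≤ (2 * p) * k := Nat.mul_le_mul_right k (by omega)
      _ = 2 * p * k := by ring
  have adm_sq : 3 * k ^ 2 * p + k ^ 3 ≤ (p + k) ^ 2 := by nlinarith
  have adm_pr : 3 * p * k ^ 2 + k ^ 3 + k ^ 2 ≤ (p + k) * (p + k + 1) + p * k := by nlinarith
  obtain ⟨e, he⟩ : ∃ e, h = 3 * k + e := ⟨h - 3 * k, by omega⟩
  have hn' : n = (p + 3 * k + e) * p ^ 2 + S + d := by rw [hn, he]; ring
  have hopt' : cubicEIP n = (p ^ 2 + θ) + (p + 3 * k + e) * (2 * p) + u + halfPerim d := by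
    rw [hopt, he]; ring
  by_cases hS : S ≤ (p + k - 1 + e) * θ
  · -- CASE I: the surplus is hosted
    have := tall_quasicube_sideRows (by omega) hk1 hdp adm_sq hθ1 (by omega) hSu hS hn' hopt'
    omega
  · -- CASE II: at most `2k` plain levels; the `q(σ+1)`-view competitor
    push Not at hS
    have hu : p + k - 1 + e < u := Nat.lt_of_mul_lt_mul_right (hS.trans_le hSu)
    obtain ⟨w, hw⟩ : ∃ w, u + w = p + 3 * k + e := ⟨p + 3 * k + e - u, by omega⟩
    have := tall_quasicube_shrunk (by omega) hk1 (hdp.trans (Nat.le_add_right _ _)) adm_pr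
      (by omega) (by omega) hw hSu (by omega) hn' hopt'
    omega

/-- **The side-face arithmetic, square cross-section, any top level `d ≤ M`**: a top level beyond
`p²` is itself top-class (`⌈2√d⌉ = 2p + 1`) and the profile re-indexes as one with `c` levels,
`u + 1` top-class levels and an empty top. [cite: MaininiPiovanoSchmidtStefanelli2019, §3 Steps 2–4] -/
private theorem sideFace_sq_height {p c d n θ u S : ℕ} (hp : 27 ≤ p) (hθ1 : 1 ≤ θ)
    (hθp : θ + 1 ≤ p) (huc : u + 1 ≤ c) (hdM : d ≤ p ^ 2 + θ) (hSu : S ≤ u * θ)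
    (hn : n = (c - 1) * p ^ 2 + S + d)
    (hopt : cubicEIP n = (p ^ 2 + θ) + (c - 1) * (2 * p) + u + halfPerim d) :
    (c - 1 - p) ^ 4 ≤ 58564 * p := by
  rcases Nat.lt_or_ge (p ^ 2) d with hQd | hdQ
  · obtain ⟨c', rfl⟩ : ∃ c', c = c' + 1 := ⟨c - 1, by omega⟩
    rw [Nat.add_sub_cancel] at hn hopt ⊢
    have hgd : halfPerim d = 2 * p + 1 :=
      halfPerim_eq_of (by omega) (by rw [qsq_two_mul_add_one]; nlinarith)
        (by rw [Nat.add_sub_cancel, qsq_two_mul]; exact hQd)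
    obtain ⟨t, ht⟩ : ∃ t, d = p ^ 2 + t := ⟨d - p ^ 2, by omega⟩
    have h := sideFace_sq_core (n := n) (c := c' + 2) (u := u + 1) (S := S + t) (d := 0) hp hθ1
      hθp (by omega) (Nat.zero_le _) (by nlinarith)
      (by rw [show c' + 2 - 1 = c' + 1 by omega, hn, ht]; ring)
      (by rw [show c' + 2 - 1 = c' + 1 by omega, hopt, hgd, halfPerim_zero]; ring)
    rw [show c' + 2 - 1 - p = c' + 1 - p by omega] at h
    exact (Nat.pow_le_pow_left (by omega) 4).trans h
  · exact sideFace_sq_core hp hθ1 hθp huc hdQ hSu hn hopt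

/-- **The side-face arithmetic, pronic cross-section (`σ = 2p + 1`), top level inside the box**
(`d ≤ p(p+1)`): projection `p(p+1) + θ` (`1 ≤ θ ≤ p`); CASE I by `tall_quasicube_odd_sideRows`,
CASE II by `tall_quasicube_odd_shrunk` (square `(p+1)²`-view); `(c − 1 − p)⁴ ≤ 58564·p` for
`p ≥ 27`. [cite: MaininiPiovanoSchmidtStefanelli2019, §3 Steps 2–4] -/
private theorem sideFace_pronic_core {p c d n θ u S : ℕ} (hp : 27 ≤ p) (hθ1 : 1 ≤ θ)
    (hθp : θ ≤ p) (huc : u + 1 ≤ c) (hdp : d ≤ p * (p + 1)) (hSu : S ≤ u * θ)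
    (hn : n = (c - 1) * (p * (p + 1)) + S + d)
    (hopt : cubicEIP n = (p * (p + 1) + θ) + (c - 1) * (2 * p + 1) + u + halfPerim d) :
    (c - 1 - p) ^ 4 ≤ 58564 * p := by
  rcases Nat.lt_or_ge (c - 1) p with hlt | hge
  · rw [show c - 1 - p = 0 by omega]; simp
  obtain ⟨h, hh⟩ : ∃ h, c - 1 = p + h := ⟨c - 1 - p, by omega⟩
  rw [show c - 1 - p = h by omega]
  rw [hh] at hn hopt
  refine height_pow_four_le hp fun k hk1 hkh hk2 => ?_
  have h3 : 3 * k ^ 2 ≤ p := by omega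
  have hkk : k ≤ k ^ 2 := by nlinarith
  have h4 : k ^ 3 ≤ 2 * p * k := by
    calc k ^ 3 = k ^ 2 * k := by ring
      _ ≤ (2 * p) * k := Nat.mul_le_mul_right k (by omega)
      _ = 2 * p * k := by ring
  have adm_pr : 3 * p * k ^ 2 + k ^ 3 + k ^ 2 ≤ (p + k) * (p + k + 1) + p * k := by nlinarith
  have adm_sq : 3 * k ^ 2 * (p + 1) + k ^ 3 ≤ (p + 1 + k) ^ 2 := by nlinarith
  obtain ⟨e, he⟩ : ∃ e, h = 3 * k + e := ⟨h - 3 * k, by omega⟩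
  have hn' : n = (p + 3 * k + e) * (p * (p + 1)) + S + d := by rw [hn, he]; ring
  have hopt' : cubicEIP n =
      (p * (p + 1) + θ) + (p + 3 * k + e) * (2 * p + 1) + u + halfPerim d := by
    rw [hopt, he]; ring
  by_cases hS : S ≤ (p + k - 1 + e) * θ
  · have := tall_quasicube_odd_sideRows (by omega) hk1 hdp adm_pr hθ1 hθp hSu hS hn' hopt'
    omega
  · push Not at hS
    have hu : p + k - 1 + e < u := Nat.lt_of_mul_lt_mul_right (hS.trans_le hSu)
    obtain ⟨e', he'⟩ : ∃ e', e = e' + 1 := ⟨e - 1, by omega⟩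
    obtain ⟨w, hw⟩ : ∃ w, u + w = p + 1 + 3 * k + e' := ⟨p + 3 * k + e - u, by omega⟩
    have hn'' : n = (p + 1 + 3 * k + e') * (p * (p + 1)) + S + d := by rw [hn', he']; ring
    have hopt'' : cubicEIP n =
        (p * (p + 1) + θ) + (p + 1 + 3 * k + e') * (2 * p + 1) + u + halfPerim d := by
      rw [hopt', he']; ring
    have := tall_quasicube_odd_shrunk (by omega) hk1 (hdp.trans (Nat.le_add_right _ _)) adm_sq
      (by omega) (by omega) hw hSu (by omega) hn'' hopt''
    omega

/-- **The side-face arithmetic, pronic cross-section, any top level `d ≤ M`** (a top level beyond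
`p(p+1)` is top-class, `⌈2√d⌉ = 2p + 2`; re-index with `c` levels and `u + 1`).
[cite: MaininiPiovanoSchmidtStefanelli2019, §3 Steps 2–4] -/
private theorem sideFace_pronic_height {p c d n θ u S : ℕ} (hp : 27 ≤ p) (hθ1 : 1 ≤ θ)
    (hθp : θ ≤ p) (huc : u + 1 ≤ c) (hdM : d ≤ p * (p + 1) + θ) (hSu : S ≤ u * θ)
    (hn : n = (c - 1) * (p * (p + 1)) + S + d)
    (hopt : cubicEIP n = (p * (p + 1) + θ) + (c - 1) * (2 * p + 1) + u + halfPerim d) :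
    (c - 1 - p) ^ 4 ≤ 58564 * p := by
  rcases Nat.lt_or_ge (p * (p + 1)) d with hQd | hdQ
  · obtain ⟨c', rfl⟩ : ∃ c', c = c' + 1 := ⟨c - 1, by omega⟩
    rw [Nat.add_sub_cancel] at hn hopt ⊢
    have i5 : (p + 1) ^ 2 = p * (p + 1) + (p + 1) := by ring
    have hgd : halfPerim d = 2 * p + 2 :=
      halfPerim_eq_of (by omega)
        (by rw [show 2 * p + 2 = 2 * (p + 1) by ring, qsq_two_mul]; omega)
        (by rw [show 2 * p + 2 - 1 = 2 * p + 1 by omega, qsq_two_mul_add_one]; exact hQd)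
    obtain ⟨t, ht⟩ : ∃ t, d = p * (p + 1) + t := ⟨d - p * (p + 1), by omega⟩
    have h := sideFace_pronic_core (n := n) (c := c' + 2) (u := u + 1) (S := S + t) (d := 0) hp
      hθ1 hθp (by omega) (Nat.zero_le _) (by nlinarith)
      (by rw [show c' + 2 - 1 = c' + 1 by omega, hn, ht]; ring)
      (by rw [show c' + 2 - 1 = c' + 1 by omega, hopt, hgd, halfPerim_zero]; ring)
    rw [show c' + 2 - 1 - p = c' + 1 - p by omega] at h
    exact (Nat.pow_le_pow_left (by omega) 4).trans h
  · exact sideFace_pronic_core hp hθ1 hθp huc hdQ hSu hn hopt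

/-- **The side-face case of the quasicube arithmetic** — the hypothesis of
`MaininiPiovanoSchmidtStefanelli2019_thm11_of_sideFace_bound`: under the quasicube accounting
with `q(σ) < M < q(σ+1)` the height excess satisfies `(c − 1 − ⌊σ/2⌋)⁴ ≤ K(σ + 1)` with the
explicit `K = 3297024⁴` (for `σ ≥ 54` the bound is `58564·⌊σ/2⌋`, by `sideFace_sq_height` /
`sideFace_pronic_height`; for `σ ≤ 53` the a-priori bound `c − 1 ≤ 62208σ` of
`quasicube_levels_le` is used). [cite: MaininiPiovanoSchmidtStefanelli2019, §3 Steps 2–4 (eq. (3.2))] -/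
theorem sideFace_height_pow_four_le :
    ∃ K : ℕ, ∀ n c M σ u d : ℕ, 2 ≤ σ → qsq σ < M → M < qsq (σ + 1) → u + 1 ≤ c →
      1 ≤ d → d ≤ M → cubicEIP n = M + (c - 1) * σ + u + halfPerim d →
      (c - 1) * qsq σ + u + d ≤ n → n ≤ (c - 1) * qsq σ + u * (M - qsq σ) + d →
      (c - 1 - σ / 2) ^ 4 ≤ K * (σ + 1) := by
  refine ⟨3297024 ^ 4, ?_⟩
  intro n c M σ u d hσ2 hQM hMQ huc _hd1 hdM hopt hlo hhi
  rcases Nat.lt_or_ge σ 54 with hσs | hσb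
  · -- bounded `σ`: the a-priori height bound
    have hc := quasicube_levels_le (by omega) hMQ hdM huc hopt hhi
    have h1 : c - 1 - σ / 2 ≤ 3297024 := by omega
    calc (c - 1 - σ / 2) ^ 4 ≤ 3297024 ^ 4 := Nat.pow_le_pow_left h1 4
      _ ≤ 3297024 ^ 4 * (σ + 1) := Nat.le_mul_of_pos_right _ (by omega)
  · obtain ⟨S, hS⟩ : ∃ S, n = (c - 1) * qsq σ + S + d := ⟨n - (c - 1) * qsq σ - d, by omega⟩
    have hSu : S ≤ u * (M - qsq σ) := by omega
    have hK : 58564 * (σ / 2) ≤ 3297024 ^ 4 * (σ + 1) :=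
      calc 58564 * (σ / 2) ≤ 58564 * (σ + 1) := Nat.mul_le_mul_left _ (by omega)
        _ ≤ 3297024 ^ 4 * (σ + 1) := Nat.mul_le_mul_right _ (by norm_num)
    obtain ⟨p, hp | hp⟩ := Nat.even_or_odd' σ
    · -- `σ = 2p`: square cross-section `p²`, `M = p² + θ`, `1 ≤ θ ≤ p − 1`
      subst hp
      have hp27 : 27 ≤ p := by omega
      rw [show 2 * p / 2 = p by omega] at hK ⊢
      rw [qsq_two_mul] at hS hSu hQM
      rw [qsq_two_mul_add_one] at hMQ
      obtain ⟨θ, rfl⟩ : ∃ θ, M = p ^ 2 + θ := ⟨M - p ^ 2, by omega⟩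
      rw [Nat.add_sub_cancel_left] at hSu
      have i4 : p * (p + 1) = p ^ 2 + p := by ring
      exact (sideFace_sq_height hp27 (by omega) (by omega) huc hdM hSu hS hopt).trans hK
    · -- `σ = 2p + 1`: pronic cross-section `p(p+1)`, `M = p(p+1) + θ`, `1 ≤ θ ≤ p`
      subst hp
      have hp27 : 27 ≤ p := by omega
      rw [show (2 * p + 1) / 2 = p by omega] at hK ⊢
      rw [qsq_two_mul_add_one] at hS hSu hQM
      rw [show 2 * p + 1 + 1 = 2 * (p + 1) by ring, qsq_two_mul] at hMQ
      obtain ⟨θ, rfl⟩ : ∃ θ, M = p * (p + 1) + θ := ⟨M - p * (p + 1), by omega⟩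
      rw [Nat.add_sub_cancel_left] at hSu
      have i5 : (p + 1) ^ 2 = p * (p + 1) + (p + 1) := by ring
      exact (sideFace_pronic_height hp27 (by omega) (by omega) huc hdM hSu hS hopt).trans hK

end SideFaceShrunk

/-! ### The discharge of [MPSS19] Theorem 1.1 -/

section Discharge

/-- **Mainini–Piovano–Schmidt–Stefanelli 2019, Theorem 1.1 — the `N^{3/4}` law in the cubic
lattice, DISCHARGED.**  Every minimizer `M_n` of the edge-isoperimetric problem among `n`-point
subsets of `ℤ³` satisfies `min_{a ∈ ℤ³} #(M_n △ (a + W_n)) ≤ K₁ n^{3/4} + o(n^{3/4})` with `K₁`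
independent of `n` (`W_n = [0, ⌊∛n⌋]³ ∩ ℤ³`).  The proof follows [MPSS19] §3 at the level of slice
profiles over the tree's solution of `EIP³` (`CubicLatticeEdgeIsoperimetry`): no gaps and the box
of a minimizer (`CubicLatticeFluctuations` §§Gap–Box), the reduction of the theorem to the
bounding-box estimate (3.2) (`…_thm11_of_box_bound`), cuboidification = Steps 1–2 as exchange
moves on optimal multisets of levels (`IsOptimalLevels.exists_quasicube_accounting`,
`…_thm11_of_quasicube_bound`), Step 3's fourth-order cancellation for pure boxes
(`tall_quasicube`, `pureBox_*`, `…_thm11_of_sideFace_bound`) and for the side face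
(`tall_quasicube_sideRows`, `tall_quasicube_shrunk` and their pronic twins,
`sideFace_height_pow_four_le`). [cite: MaininiPiovanoSchmidtStefanelli2019, Theorem 1.1] -/
theorem MaininiPiovanoSchmidtStefanelli2019_thm11_holds :
    MaininiPiovanoSchmidtStefanelli2019_thm11 :=
  MaininiPiovanoSchmidtStefanelli2019_thm11_of_sideFace_bound sideFace_height_pow_four_le

end Discharge

/-! ### Mainini–Schmidt 2020, Theorem 1.1 (i) at `d = 3` -/

section MaininiSchmidtThree

open Filter Asymptotics Literature.Probability.LatticeModels
open scoped symmDiff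

/-- `{1,…,⌊∛n⌋}³ ⊆ {0,…,⌊∛n⌋}³`: the Mainini–Schmidt Wulff cube sits inside the
Mainini–Piovano–Schmidt–Stefanelli one. [cite: MaininiSchmidt2020, §1 (W_n); MaininiPiovanoSchmidtStefanelli2019, §1 eq. (2)] -/
theorem wulffCube_three_subset_wulffCubeZero (n : ℕ) : wulffCube 3 n ⊆ wulffCubeZero n := by
  intro w hw
  rw [wulffCube, Fintype.mem_piFinset] at hw
  rw [wulffCubeZero, Fintype.mem_piFinset]
  intro i
  have h := hw i
  rw [mem_Icc] at h ⊢
  exact ⟨by omega, h.2⟩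

/-- The two Wulff cubes differ by `(ℓ + 1)³ − ℓ³` points, `ℓ = ⌊∛n⌋`.
[cite: MaininiSchmidt2020, §1 (W_n); MaininiPiovanoSchmidtStefanelli2019, §1 eq. (2)] -/
theorem card_wulffCubeZero_symmDiff_wulffCube (n : ℕ) :
    #(wulffCubeZero n ∆ wulffCube 3 n) + latticeRootFloor 3 n ^ 3 = (latticeRootFloor 3 n + 1) ^ 3 := by
  rw [symmDiff_of_ge (wulffCube_three_subset_wulffCubeZero n), ← card_wulffCube 3 n,
    ← card_wulffCubeZero n]
  exact card_sdiff_add_card_eq_card (wulffCube_three_subset_wulffCubeZero n)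

/-- `ℓ² ≤ n^{3/4}` for `ℓ = ⌊∛n⌋` (indeed `ℓ⁸ ≤ ℓ⁹ ≤ n³`). [cite: MaininiSchmidt2020, §1 (W_n)] -/
private theorem latticeRootFloor_sq_le_rpow (n : ℕ) :
    ((latticeRootFloor 3 n : ℕ) : ℝ) ^ 2 ≤ (n : ℝ) ^ ((3 : ℝ) / 4) := by
  set l := latticeRootFloor 3 n with hl
  obtain ⟨h1, -⟩ := latticeRootFloor_three_spec n
  rw [← hl] at h1
  rcases Nat.eq_zero_or_pos l with hl0 | hlpos
  · rw [hl0]; simp only [Nat.cast_zero, ne_eq, OfNat.ofNat_ne_zero, not_false_eq_true, zero_pow]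
    positivity
  have h8 : l ^ 8 ≤ n ^ 3 := by
    calc l ^ 8 ≤ l ^ 9 := Nat.pow_le_pow_right hlpos (by norm_num)
      _ = (l ^ 3) ^ 3 := by ring
      _ ≤ n ^ 3 := Nat.pow_le_pow_left h1 3
  have h8R : ((l : ℝ) ^ 2) ^ (4 : ℕ) ≤ ((n : ℝ) ^ ((3 : ℝ) / 4)) ^ (4 : ℕ) := by
    have e1 : ((l : ℝ) ^ 2) ^ (4 : ℕ) = ((l ^ 8 : ℕ) : ℝ) := by push_cast; ring
    have e2 : ((n : ℝ) ^ ((3 : ℝ) / 4)) ^ (4 : ℕ) = ((n ^ 3 : ℕ) : ℝ) := by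
      rw [← Real.rpow_natCast, ← Real.rpow_mul (Nat.cast_nonneg n)]
      push_cast
      rw [show (3 : ℝ) / 4 * 4 = ((3 : ℕ) : ℝ) by norm_num, Real.rpow_natCast]
    rw [e1, e2]
    exact_mod_cast h8
  exact le_of_pow_le_pow_left₀ (by norm_num) (by positivity) h8R

/-- **Mainini–Schmidt 2020, Theorem 1.1 (i) AT `d = 3` — a theorem** (the `d = 3` instance of the
vendored fact `MaininiSchmidt2020_thm11_upper`): there is `K > 0` such that every `EIP³` minimizer
`C` with `n` points has a translate `C − a` with `#((C − a) △ W_n) ≤ K·n^{3/4}`,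
`W_n = {1,…,⌊∛n⌋}³` and `3/4 = (d − 1 + 2^{1−d})/d` at `d = 3`.  From [MPSS19] Theorem 1.1
(`MaininiPiovanoSchmidtStefanelli2019_thm11_holds`): the two Wulff cubes `{0,…,ℓ}³ ⊇ {1,…,ℓ}³`
differ by `(ℓ+1)³ − ℓ³ ≤ 7ℓ² ≤ 7n^{3/4}` points, and the `o(n^{3/4})` remainder is absorbed into
the constant (it is `≤ n^{3/4}` beyond some `N₀`, and `#(… △ …) ≤ 2n ≤ 2N₀·n^{3/4}` before).
With `MaininiSchmidt2020_thm11_lower_three` both halves of [MS20] Theorem 1.1 hold at `d = 3`.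
[cite: MaininiSchmidt2020, Theorem 1.1 (i) (d = 3); MaininiPiovanoSchmidtStefanelli2019, Theorem 1.1] -/
theorem MaininiSchmidt2020_thm11_upper_three :
    ∃ K : ℝ, 0 < K ∧ ∀ (n : ℕ) (C : Finset (Site 3)), IsEIPMinimizer C → #C = n →
      ∃ a : Site 3,
        (#((C.image fun x => x - a) ∆ wulffCube 3 n) : ℝ) ≤
          K * (n : ℝ) ^ maximalFluctuationExponent 3 := by
  classical
  obtain ⟨K₁, hK₁, r, hr, hmain⟩ := MaininiPiovanoSchmidtStefanelli2019_thm11_holds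
  -- the remainder is eventually `≤ n^{3/4}`
  obtain ⟨N₀, hN₀⟩ := eventually_atTop.1 (hr.bound one_pos)
  refine ⟨K₁ + 8 + 2 * N₀, by positivity, fun n C hC hCn => ?_⟩
  rw [maximalFluctuationExponent_three]
  obtain ⟨hl1, hl2⟩ := latticeRootFloor_three_spec n
  set l := latticeRootFloor 3 n with hl
  have hpow0 : (0 : ℝ) ≤ (n : ℝ) ^ ((3 : ℝ) / 4) := by positivity
  rcases Nat.eq_zero_or_pos n with hn0 | hnpos
  · -- `n = 0`: everything is empty
    subst hn0
    refine ⟨0, ?_⟩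
    have hC0 : C = ∅ := card_eq_zero.1 hCn
    have hl0 : l = 0 := by
      by_contra h
      have : 1 ≤ l ^ 3 := Nat.one_le_pow _ _ (by omega)
      omega
    have hW : wulffCube 3 0 = ∅ := by
      rw [← card_eq_zero, card_wulffCube, ← hl, hl0]; rfl
    rw [hC0, hW, image_empty]
    simp only [symmDiff_self, Finset.bot_eq_empty, card_empty, Nat.cast_zero]
    positivity
  have hn1 : (1 : ℝ) ≤ n := by exact_mod_cast hnpos
  have hpow1 : (1 : ℝ) ≤ (n : ℝ) ^ ((3 : ℝ) / 4) := Real.one_le_rpow hn1 (by norm_num)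
  have hl1' : 1 ≤ l := by
    by_contra h
    have : l = 0 := by omega
    rw [this] at hl2
    omega
  -- crude bound `#((C − a) △ W_n) ≤ 2n`, used below `N₀`
  have crude : ∀ a : Site 3, #((C.image fun x => x - a) ∆ wulffCube 3 n) ≤ 2 * n := by
    intro a
    calc #((C.image fun x => x - a) ∆ wulffCube 3 n)
        ≤ #((C.image fun x => x - a) ∪ wulffCube 3 n) := card_le_card symmDiff_subset_union
      _ ≤ #(C.image fun x => x - a) + #(wulffCube 3 n) := card_union_le _ _
      _ ≤ #C + l ^ 3 := Nat.add_le_add card_image_le (by rw [card_wulffCube])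
      _ ≤ 2 * n := by omega
  rcases Nat.lt_or_ge n N₀ with hsmall | hbig
  · refine ⟨0, ?_⟩
    have h1 : (#((C.image fun x => x - 0) ∆ wulffCube 3 n) : ℝ) ≤ 2 * N₀ := by
      have := crude 0
      have h2 : ((2 * n : ℕ) : ℝ) ≤ 2 * N₀ := by
        have : 2 * n ≤ 2 * N₀ := by omega
        exact_mod_cast this
      exact le_trans (by exact_mod_cast this) h2
    calc (#((C.image fun x => x - 0) ∆ wulffCube 3 n) : ℝ) ≤ 2 * N₀ := h1
      _ ≤ 2 * N₀ * (n : ℝ) ^ ((3 : ℝ) / 4) := by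
          have h0 : (0 : ℝ) ≤ 2 * N₀ := by positivity
          nlinarith
      _ ≤ (K₁ + 8 + 2 * N₀) * (n : ℝ) ^ ((3 : ℝ) / 4) := by nlinarith
  · -- `n ≥ N₀`: [MPSS19] Theorem 1.1 with the remainder `≤ n^{3/4}`, then change the cube
    obtain ⟨a, ha⟩ := hmain n C hC hCn
    have hrn : r n ≤ (n : ℝ) ^ ((3 : ℝ) / 4) := by
      have h := hN₀ n hbig
      rw [one_mul, Real.norm_eq_abs, Real.norm_eq_abs, abs_of_nonneg hpow0] at h
      exact (le_abs_self _).trans h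
    refine ⟨a, ?_⟩
    -- `#((C − a) △ W⁰) = #(C △ (a + W⁰))`
    have hsub : Function.Injective fun x : Site 3 => x - a := sub_left_injective
    have hW : (((wulffCubeZero n).image fun w => a + w).image fun x => x - a) = wulffCubeZero n := by
      rw [image_image]
      have : ((fun x : Site 3 => x - a) ∘ fun w => a + w) = id := by
        funext w; simp
      rw [this, image_id]
    have hcard0 : #((C.image fun x => x - a) ∆ wulffCubeZero n) =
        #(C ∆ (wulffCubeZero n).image fun w => a + w) := by
      conv_lhs => rw [← hW, ← image_symmDiff _ _ hsub]
      exact card_image_of_injective _ hsub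
    -- triangle inequality for `△` and the difference of the two cubes
    have htri : #((C.image fun x => x - a) ∆ wulffCube 3 n) ≤
        #((C.image fun x => x - a) ∆ wulffCubeZero n) + #(wulffCubeZero n ∆ wulffCube 3 n) :=
      (card_le_card (symmDiff_triangle _ (wulffCubeZero n) _)).trans (card_union_le _ _)
    have hcubes := card_wulffCubeZero_symmDiff_wulffCube n
    rw [← hl] at hcubes
    have hdiff : #(wulffCubeZero n ∆ wulffCube 3 n) ≤ 7 * l ^ 2 := by
      have e : (l + 1) ^ 3 = l ^ 3 + 3 * l ^ 2 + 3 * l + 1 := by ring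
      have : 3 * l + 1 ≤ 4 * l ^ 2 := by nlinarith
      omega
    have hl2R : ((l : ℕ) : ℝ) ^ 2 ≤ (n : ℝ) ^ ((3 : ℝ) / 4) := latticeRootFloor_sq_le_rpow n
    have hnat : #((C.image fun x => x - a) ∆ wulffCube 3 n) ≤
        #(C ∆ (wulffCubeZero n).image fun w => a + w) + 7 * l ^ 2 := by
      rw [← hcard0]; omega
    have hR : (#((C.image fun x => x - a) ∆ wulffCube 3 n) : ℝ) ≤
        (#(C ∆ (wulffCubeZero n).image fun w => a + w) : ℝ) + 7 * ((l : ℕ) : ℝ) ^ 2 := by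
      exact_mod_cast hnat
    calc (#((C.image fun x => x - a) ∆ wulffCube 3 n) : ℝ)
        ≤ (#(C ∆ (wulffCubeZero n).image fun w => a + w) : ℝ) + 7 * ((l : ℕ) : ℝ) ^ 2 := hR
      _ ≤ (K₁ * (n : ℝ) ^ ((3 : ℝ) / 4) + r n) + 7 * (n : ℝ) ^ ((3 : ℝ) / 4) := by
          nlinarith
      _ ≤ (K₁ + 8 + 2 * N₀) * (n : ℝ) ^ ((3 : ℝ) / 4) := by
          have h0 : (0 : ℝ) ≤ 2 * N₀ * (n : ℝ) ^ ((3 : ℝ) / 4) := by positivity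
          nlinarith

end MaininiSchmidtThree

/-! ### [MPSS19] eq. (3.2): the bounding box of a minimizer is a cube up to `O(n^{1/12})` -/

section BoxSharp

open Literature.Probability.LatticeModels

/-- **The quasicube arithmetic in full** ([MPSS19] §3 Steps 3–4 at the level of slice profiles):
under the quasicube accounting `G₃(n) = M + (c−1)σ + u + ⌈2√d⌉`, `q(σ) ≤ M < q(σ+1)`, the height
excess obeys `(c − 1 − ⌊σ/2⌋)⁴ ≤ K(σ + 1)` — the pure-box case (`M = q(σ)`:
`pureBox_sq_height_pow_four_le`, `pureBox_pronic_height_pow_four_le`) merged with the side-face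
case (`sideFace_height_pow_four_le`); this is the hypothesis of
`MaininiPiovanoSchmidtStefanelli2019_thm11_of_quasicube_bound`, now a theorem.
[cite: MaininiPiovanoSchmidtStefanelli2019, §3 Steps 3–4 (ℓ₃ − ℓ ≤ √6 α^{1/4} ℓ^{1/4} + o(ℓ^{1/4}))] -/
theorem quasicube_height_pow_four_le :
    ∃ K : ℕ, ∀ n c M σ u d : ℕ, 2 ≤ σ → qsq σ ≤ M → M < qsq (σ + 1) → u + 1 ≤ c →
      1 ≤ d → d ≤ M → cubicEIP n = M + (c - 1) * σ + u + halfPerim d →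
      (c - 1) * qsq σ + u + d ≤ n → n ≤ (c - 1) * qsq σ + u * (M - qsq σ) + d →
      (c - 1 - σ / 2) ^ 4 ≤ K * (σ + 1) := by
  obtain ⟨K, hK⟩ := sideFace_height_pow_four_le
  refine ⟨max K 5000, ?_⟩
  intro n c M σ u d hσ2 hQM hMQ huc hd1 hdM hopt hlo hhi
  rcases hQM.lt_or_eq with hlt | heq
  · exact (hK n c M σ u d hσ2 hlt hMQ huc hd1 hdM hopt hlo hhi).trans
      (Nat.mul_le_mul_right _ (le_max_left _ _))
  · -- `M = q(σ)`: a pure box, `u = 0`, `n = (c-1) q(σ) + d`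
    subst heq
    rw [Nat.sub_self, mul_zero, add_zero] at hhi
    have hu : u = 0 := by omega
    subst hu
    have hn : n = (c - 1) * qsq σ + d := by omega
    rw [add_zero] at hopt
    have h5000 : 5000 * (σ / 2) ≤ max K 5000 * (σ + 1) :=
      (Nat.mul_le_mul_right _ (le_max_right _ _)).trans' (Nat.mul_le_mul_left _ (by omega))
    obtain ⟨p, hp | hp⟩ := Nat.even_or_odd' σ
    · subst hp
      have hp1 : 1 ≤ p := by omega
      rw [qsq_two_mul] at hn hopt hdM
      have h := pureBox_sq_height_pow_four_le hp1 hdM hn (by rw [hopt, pow_two])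
      rw [show 2 * p / 2 = p by omega] at h5000 ⊢
      exact h.trans h5000
    · subst hp
      have hp1 : 1 ≤ p := by omega
      rw [qsq_two_mul_add_one] at hn hopt hdM
      have h := pureBox_pronic_height_pow_four_le hp1 hdM hn hopt
      rw [show (2 * p + 1) / 2 = p by omega] at h5000 ⊢
      exact h.trans h5000

/-- **[MPSS19] eq. (3.2) — the bounding box of an `EIP³` minimizer is a cube up to `O(n^{1/12})`**
(integer form): there is an absolute `K` such that every non-empty `EIP³` minimizer `C` with `n`
points has all three sides `T_s = #{x_s : x ∈ C}` within `2D + 4` of `⌊∛n⌋ + 1` for some `D`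
with `D⁴ ≤ K(3⌊∛n⌋ + 5)` — the printed "`max_i |ℓ_i − ℓ_n| ≤ K n^{1/12} + o(n^{1/12})`"; by
`IsEIPMinimizer.exists_box_dev_of_quasicube` and `quasicube_height_pow_four_le`.
[cite: MaininiPiovanoSchmidtStefanelli2019, §3 eq. (3.2) and Steps 1–5] -/
theorem IsEIPMinimizer.box_sides_sharp :
    ∃ K : ℕ, ∀ C : Finset (Site 3), IsEIPMinimizer C → C.Nonempty →
      ∃ D : ℕ, D ^ 4 ≤ K * (3 * latticeRootFloor 3 #C + 5) ∧ ∀ s : Fin 3,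
        latticeRootFloor 3 #C + 1 ≤ #(C.image fun x => x s) + (2 * D + 4) ∧
          #(C.image fun x => x s) ≤ latticeRootFloor 3 #C + 1 + (2 * D + 4) := by
  obtain ⟨K, hK⟩ := quasicube_height_pow_four_le
  exact ⟨K, fun C hC hne => hC.exists_box_dev_of_quasicube hne hK⟩

end BoxSharp

end Literature.MathematicalPhysics.StatisticalMechanics
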